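import Literature.MathematicalPhysics.QuantumManyBody.PeriodicBoseGasJastrow
import HarnessLib

/-!
# Route `BECRichardsonGaudin`, crux `BeliaevDeformationBound` (stmt-AtomisticToContinuum-14804):
# the energy of the Jastrow trial state (stub B1b of the line `registered`)

Worker file for the registered stub `stub_jastrowEnergy` of the skeleton
`Cruxes/BeliaevDeformationBound/Lines/birth.lean`, supporting (not closing)
stmt-AtomisticToContinuum-14804.

The tree theorem `LSSY2005_jastrowBound_holds` (`PeriodicBoseGasJastrow.lean`) bounds the periodic
ground-state energy `E₀^per(N, L)` by the energy of the normalised symmetric product (Jastrow) state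
`Ψ_J = ∏_{i<j} Φ(xᵢ - xⱼ)/√ν` (`IsPairProfile.trialState`), and only in its last line passes to the
infimum over trial states. This file records the PER-STATE form of the same computation:
`⟨Ψ_J, HΨ_J⟩ ≤ N(N-1)/2 · E/(L³ - (N-1)I) + N(N-1)(N-2) K²/(L³ - (N-1)I)²`
for every pair profile `φ` with `E₁ ≤ E`, `∫(1-φ²) ≤ I`, `∫ φ|∇φ| ≤ K` and `(N-1)I < L³`; the proof
is the tree proof verbatim [LSSY2005, Thm. 2.2, proof, (2.19)–(2.31)]: the pointwise kinetic bound
and the potential bound integrated against the one- and two-particle-eliminated norms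
(`IsPairProfile.lintegral_kinetic_le`, `IsPairProfile.lintegral_potential_le`,
`IsPairProfile.jastrowNormR_erase_le'`), the counting of pair and three-body terms, and the final
algebra.

References: E. H. Lieb, R. Seiringer, J. P. Solovej, J. Yngvason, *The Mathematics of the Bose Gas
and its Condensation*, Oberwolfach Seminars 34, Birkhäuser 2005, arXiv:cond-mat/0610117, Thm. 2.2 and
its proof (2.15)–(2.33); F. J. Dyson, *Ground-state energy of a hard-sphere gas*, Phys. Rev. 106
(1957) 20–26.
-/

noncomputable section

namespace Summit.AtomisticToContinuum.BoseEinsteinCondensation.Theorems.BeliaevDeformationBound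

open scoped ENNReal
open MeasureTheory Filter
open Literature.MathematicalPhysics.QuantumManyBody.BoseGas

/-- **Energy of the Jastrow trial state** (LSSY 2005, proof of Thm. 2.2, step 2, per-state form).
For measurable `v ≥ 0`, `N ≥ 2`, a pair profile `φ` with cut-off `b`, `0 < 2b < L`, and real bounds
`E₁ = 2𝓔[φ] ≤ E`, `∫(1-φ²) ≤ I`, `∫ φ|∇φ| ≤ K` with `(N-1)I < L³`, the normalised product state
`Ψ_J = ∏_{i<j} Φ(xᵢ - xⱼ)/√ν` (`IsPairProfile.trialState`) satisfies
`⟨Ψ_J, HΨ_J⟩ ≤ N(N-1)/2 · E/(L³-(N-1)I) + N(N-1)(N-2) K²/(L³-(N-1)I)²`.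
(The tree's `LSSY2005_jastrowBound_holds` is this bound followed by `periodicGroundStateEnergy_le`.)
[cite: LSSY2005, Thm. 2.2, proof, (2.19)–(2.31); Dyson1957] -/
theorem stub_jastrowEnergy :
  ∀ (v : ℝ → ENNReal), Measurable v →
    ∀ (N : ℕ) (L b : ℝ) (φ : Space → ℝ) (hφ : IsPairProfile b φ) (hL : 0 < L) (hbL : 2 * b < L)
      (hν : 0 < jastrowNormR L φ (Finset.univ : Finset (Fin N))) (E I K : ℝ),
      2 ≤ N → 0 < b → 0 ≤ E → 0 ≤ I → 0 ≤ K →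
      profileEnergy v φ ≤ ENNReal.ofReal E → profileDefect φ ≤ ENNReal.ofReal I →
      profileK φ ≤ ENNReal.ofReal K → ((N : ℝ) - 1) * I < L ^ 3 →
      periodicEnergy v (hφ.trialState hL hbL hν) ≤ ENNReal.ofReal
        (N * ((N : ℝ) - 1) / 2 * E / (L ^ 3 - ((N : ℝ) - 1) * I) +
          N * ((N : ℝ) - 1) * ((N : ℝ) - 2) * K ^ 2 / (L ^ 3 - ((N : ℝ) - 1) * I) ^ 2) := by
  intro v hv N L b φ hφ hL hbL hν E I K hN _hb hE0 hI0 hK0 hE hI hK hNI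
  classical
  -- real parameters
  have hN2 : (2 : ℝ) ≤ N := by exact_mod_cast hN
  have hN1 : 1 ≤ N := by omega
  have hL3 : 0 < L ^ 3 := by positivity
  have hden : 0 < L ^ 3 - ((N : ℝ) - 1) * I := by linarith
  set D : ℝ := L ^ 3 / (L ^ 3 - ((N : ℝ) - 1) * I) with hD
  have hD0 : 0 < D := div_pos hL3 hden
  set ν := jastrowNormR L φ (Finset.univ : Finset (Fin N)) with hν_def
  have hν0 : 0 < ν := hν
  -- norms of the states with one or two particles eliminated
  have hn1 : ∀ k : Fin N,
      jastrowNormSq L φ (Finset.univ.erase k) ≤ ENNReal.ofReal (D * ν) := by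
    intro k
    rw [← hφ.ofReal_jastrowNormR]
    exact ENNReal.ofReal_le_ofReal
      (hφ.jastrowNormR_erase_le' hL hbL hI0 hI hNI Finset.univ (Finset.mem_univ k))
  have hn2 : ∀ i j : Fin N, j ≠ i →
      jastrowNormSq L φ ((Finset.univ.erase i).erase j) ≤ ENNReal.ofReal (D ^ 2 * ν) := by
    intro i j hji
    rw [← hφ.ofReal_jastrowNormR]
    refine ENNReal.ofReal_le_ofReal ?_
    have h1 := hφ.jastrowNormR_erase_le' hL hbL hI0 hI hNI (Finset.univ.erase i)
      (Finset.mem_erase.mpr ⟨hji, Finset.mem_univ j⟩)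
    have h2 := hφ.jastrowNormR_erase_le' hL hbL hI0 hI hNI Finset.univ (Finset.mem_univ i)
    calc jastrowNormR L φ ((Finset.univ.erase i).erase j)
        ≤ D * jastrowNormR L φ (Finset.univ.erase i) := h1
      _ ≤ D * (D * ν) := mul_le_mul_of_nonneg_left h2 hD0.le
      _ = D ^ 2 * ν := by ring
  -- the one-body integrals of the profile, as real numbers
  set G := ∫⁻ x, gradSq φ x with hG
  set P := ∫⁻ x, v ‖x‖ * ENNReal.ofReal (φ x ^ 2) with hP
  have hGP : 2 * G + P = profileEnergy v φ := (profileEnergy_eq hφ.contDiff).symm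
  have hGP' : 2 * G + P ≤ ENNReal.ofReal E := hGP ▸ hE
  have hGtop : G ≠ ⊤ := by
    refine ne_top_of_le_ne_top ENNReal.ofReal_ne_top ((le_trans ?_ le_self_add).trans hGP')
    rw [two_mul]; exact le_self_add
  have hPtop : P ≠ ⊤ := ne_top_of_le_ne_top ENNReal.ofReal_ne_top (le_add_self.trans hGP')
  have hKtop : profileK φ ≠ ⊤ := ne_top_of_le_ne_top ENNReal.ofReal_ne_top hK
  set g := G.toReal with hg
  set p := P.toReal with hp
  set κ := (profileK φ).toReal with hκ
  have hg0 : 0 ≤ g := ENNReal.toReal_nonneg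
  have hp0 : 0 ≤ p := ENNReal.toReal_nonneg
  have hκ0 : 0 ≤ κ := ENNReal.toReal_nonneg
  have hGe : G = ENNReal.ofReal g := (ENNReal.ofReal_toReal hGtop).symm
  have hPe : P = ENNReal.ofReal p := (ENNReal.ofReal_toReal hPtop).symm
  have hKe : profileK φ = ENNReal.ofReal κ := (ENNReal.ofReal_toReal hKtop).symm
  have hgp : 2 * g + p ≤ E := by
    have h2G : (2 * G) ≠ ⊤ := ENNReal.mul_ne_top ENNReal.ofNat_ne_top hGtop
    have := ENNReal.toReal_le_of_le_ofReal hE0 hGP'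
    rwa [ENNReal.toReal_add h2G hPtop, ENNReal.toReal_mul, ENNReal.toReal_ofNat] at this
  have hκK : κ ≤ K := ENNReal.toReal_le_of_le_ofReal hK0 hK
  have hL3e : (ENNReal.ofReal L ^ 3)⁻¹ = ENNReal.ofReal ((L ^ 3)⁻¹) := by
    rw [← ENNReal.ofReal_pow hL.le, ENNReal.ofReal_inv_of_pos hL3]
  have hL3i : 0 ≤ (L ^ 3)⁻¹ := inv_nonneg.mpr hL3.le
  -- Step 1: the three families of terms, each bounded by a real number
  have hT1 : ∀ k : Fin N, ∀ l ∈ Finset.univ.erase k,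
      (ENNReal.ofReal L ^ 3)⁻¹ * G * jastrowNormSq L φ (Finset.univ.erase k) ≤
        ENNReal.ofReal ((L ^ 3)⁻¹ * g * (D * ν)) := by
    intro k l _
    rw [hL3e, hGe, ← ENNReal.ofReal_mul hL3i, ENNReal.ofReal_mul (mul_nonneg hL3i hg0)]
    exact mul_le_mul' le_rfl (hn1 k)
  have hT2 : ∀ k : Fin N, ∀ i ∈ Finset.univ.erase k, ∀ j ∈ (Finset.univ.erase k).erase i,
      (ENNReal.ofReal L ^ 3)⁻¹ * profileK φ * ((ENNReal.ofReal L ^ 3)⁻¹ * profileK φ *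
          jastrowNormSq L φ ((Finset.univ.erase i).erase j)) ≤
        ENNReal.ofReal ((L ^ 3)⁻¹ * κ * ((L ^ 3)⁻¹ * κ * (D ^ 2 * ν))) := by
    intro k i _ j hj
    have hji : j ≠ i := Finset.ne_of_mem_erase hj
    rw [hL3e, hKe, ← ENNReal.ofReal_mul hL3i,
      ENNReal.ofReal_mul (mul_nonneg hL3i hκ0), ENNReal.ofReal_mul (mul_nonneg hL3i hκ0)]
    exact mul_le_mul' le_rfl (mul_le_mul' le_rfl (hn2 i j hji))
  have hT3 : ∀ i : Fin N, ∀ j ∈ Finset.univ.filter (i < ·),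
      (ENNReal.ofReal L ^ 3)⁻¹ * P * jastrowNormSq L φ (Finset.univ.erase i) ≤
        ENNReal.ofReal ((L ^ 3)⁻¹ * p * (D * ν)) := by
    intro i j _
    rw [hL3e, hPe, ← ENNReal.ofReal_mul hL3i, ENNReal.ofReal_mul (mul_nonneg hL3i hp0)]
    exact mul_le_mul' le_rfl (hn1 i)
  -- Step 2: sum them
  have hr1 : 0 ≤ (L ^ 3)⁻¹ * g * (D * ν) := by positivity
  have hr2 : 0 ≤ (L ^ 3)⁻¹ * κ * ((L ^ 3)⁻¹ * κ * (D ^ 2 * ν)) := by positivity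
  have hr3 : 0 ≤ (L ^ 3)⁻¹ * p * (D * ν) := by positivity
  have hNNr : 0 ≤ (N : ℝ) * ((N : ℝ) - 1) := mul_nonneg (Nat.cast_nonneg _) (by linarith)
  have hNNNr : 0 ≤ (N : ℝ) * ((N : ℝ) - 1) * ((N : ℝ) - 2) := mul_nonneg hNNr (by linarith)
  have hNN1 : ((N : ℝ≥0∞) * ((N - 1 : ℕ) : ℝ≥0∞)) = ENNReal.ofReal ((N : ℝ) * ((N : ℝ) - 1)) := by
    rw [← ENNReal.ofReal_natCast, ← ENNReal.ofReal_natCast, Nat.cast_sub hN1, Nat.cast_one,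
      ← ENNReal.ofReal_mul (Nat.cast_nonneg _)]
  have hNN2 : ((N : ℝ≥0∞) * ((N - 1 : ℕ) : ℝ≥0∞) * ((N - 2 : ℕ) : ℝ≥0∞)) =
      ENNReal.ofReal ((N : ℝ) * ((N : ℝ) - 1) * ((N : ℝ) - 2)) := by
    rw [hNN1, ← ENNReal.ofReal_natCast, Nat.cast_sub hN, Nat.cast_ofNat,
      ← ENNReal.ofReal_mul hNNr]
  have hkin : ∫⁻ X in cellN N L, kineticDensity (jastrowC L φ) X ≤
      ENNReal.ofReal ((N : ℝ) * ((N : ℝ) - 1) * ((L ^ 3)⁻¹ * g * (D * ν)) +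
        (N : ℝ) * ((N : ℝ) - 1) * ((N : ℝ) - 2) *
          ((L ^ 3)⁻¹ * κ * ((L ^ 3)⁻¹ * κ * (D ^ 2 * ν)))) := by
    refine (hφ.lintegral_kinetic_le hL hbL).trans ?_
    rw [ENNReal.ofReal_add (mul_nonneg hNNr hr1) (mul_nonneg hNNNr hr2)]
    refine add_le_add ?_ ?_
    · calc _ ≤ ∑ k : Fin N, ∑ _l ∈ Finset.univ.erase k,
              ENNReal.ofReal ((L ^ 3)⁻¹ * g * (D * ν)) :=
            Finset.sum_le_sum fun k _ => Finset.sum_le_sum fun l hl => hT1 k l hl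
        _ = _ := by rw [sum_erase_const, hNN1, ← ENNReal.ofReal_mul hNNr]
    · calc _ ≤ ∑ k : Fin N, ∑ i ∈ Finset.univ.erase k, ∑ _j ∈ (Finset.univ.erase k).erase i,
            ENNReal.ofReal ((L ^ 3)⁻¹ * κ * ((L ^ 3)⁻¹ * κ * (D ^ 2 * ν))) :=
            Finset.sum_le_sum fun k _ => Finset.sum_le_sum fun i hi =>
              Finset.sum_le_sum fun j hj => hT2 k i hi j hj
        _ = _ := by rw [sum_erase_erase_const, hNN2, ← ENNReal.ofReal_mul hNNNr]
  have hpot : ∫⁻ X in cellN N L,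
      periodicInteraction v L X * ENNReal.ofReal (jastrow L φ Finset.univ X ^ 2) ≤
        ENNReal.ofReal ((N : ℝ) * ((N : ℝ) - 1) / 2 * ((L ^ 3)⁻¹ * p * (D * ν))) := by
    refine (hφ.lintegral_potential_le hL hbL hv).trans ?_
    calc _ ≤ ∑ i : Fin N, ∑ _j ∈ Finset.univ.filter (i < ·),
            ENNReal.ofReal ((L ^ 3)⁻¹ * p * (D * ν)) :=
          Finset.sum_le_sum fun i _ => Finset.sum_le_sum fun j hj => hT3 i j hj
      _ = _ := by
          rw [sum_filter_lt_const hN1, ← ENNReal.ofReal_mul (div_nonneg hNNr zero_le_two)]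
  -- Step 3: the energy of the normalised trial state
  set A : ℝ := (N : ℝ) * ((N : ℝ) - 1) * ((L ^ 3)⁻¹ * g * (D * ν)) +
      (N : ℝ) * ((N : ℝ) - 1) * ((N : ℝ) - 2) * ((L ^ 3)⁻¹ * κ * ((L ^ 3)⁻¹ * κ * (D ^ 2 * ν))) +
      (N : ℝ) * ((N : ℝ) - 1) / 2 * ((L ^ 3)⁻¹ * p * (D * ν)) with hA
  have hA1 : 0 ≤ (N : ℝ) * ((N : ℝ) - 1) * ((L ^ 3)⁻¹ * g * (D * ν)) +
      (N : ℝ) * ((N : ℝ) - 1) * ((N : ℝ) - 2) * ((L ^ 3)⁻¹ * κ * ((L ^ 3)⁻¹ * κ * (D ^ 2 * ν))) :=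
    add_nonneg (mul_nonneg hNNr hr1) (mul_nonneg hNNNr hr2)
  have hA2 : 0 ≤ (N : ℝ) * ((N : ℝ) - 1) / 2 * ((L ^ 3)⁻¹ * p * (D * ν)) :=
    mul_nonneg (div_nonneg hNNr zero_le_two) hr3
  set Ψt := hφ.trialState hL hbL hν with hΨt
  have htot : periodicEnergy v Ψt ≤ ENNReal.ofReal (ν⁻¹ * A) := by
    rw [hΨt, hφ.periodicEnergy_trialState hL hbL hν v,
      ENNReal.ofReal_mul (inv_nonneg.mpr hν0.le)]
    refine mul_le_mul' le_rfl ?_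
    rw [lintegral_add_left (kineticDensity_measurable _), hA, ENNReal.ofReal_add hA1 hA2]
    exact add_le_add hkin hpot
  -- Step 4: the algebra `ν⁻¹ A ≤ N(N-1)/2 · E/(L³-(N-1)I) + N(N-1)(N-2) K²/(L³-(N-1)I)²`
  have hB : ν⁻¹ * A = (N : ℝ) * ((N : ℝ) - 1) / 2 * (2 * g + p) / (L ^ 3 - ((N : ℝ) - 1) * I) +
      (N : ℝ) * ((N : ℝ) - 1) * ((N : ℝ) - 2) * κ ^ 2 / (L ^ 3 - ((N : ℝ) - 1) * I) ^ 2 := by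
    rw [hA, hD]
    field_simp
    ring
  have hNN : 0 ≤ (N : ℝ) * ((N : ℝ) - 1) := by nlinarith
  have hfin : ν⁻¹ * A ≤ (N : ℝ) * ((N : ℝ) - 1) / 2 * E / (L ^ 3 - ((N : ℝ) - 1) * I) +
      (N : ℝ) * ((N : ℝ) - 1) * ((N : ℝ) - 2) * K ^ 2 / (L ^ 3 - ((N : ℝ) - 1) * I) ^ 2 := by
    rw [hB]
    refine add_le_add ?_ ?_
    · refine div_le_div_of_nonneg_right ?_ hden.le
      exact mul_le_mul_of_nonneg_left hgp (by positivity)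
    · refine div_le_div_of_nonneg_right ?_ (by positivity)
      exact mul_le_mul_of_nonneg_left (pow_le_pow_left₀ hκ0 hκK 2) (by nlinarith)
  exact htot.trans (ENNReal.ofReal_le_ofReal hfin)

end Summit.AtomisticToContinuum.BoseEinsteinCondensation.Theorems.BeliaevDeformationBound

end
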